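import Literature.NumberTheory.EllipticCurves.Rank1Residual.Typed.SelmerCardCertificateRankZero
import Literature.NumberTheory.EllipticCurves.Rank1Residual.EisensteinGoodComplement
import Literature.NumberTheory.EllipticCurves.Wuthrich2014.ShaBoundProofs
import Literature.NumberTheory.EllipticCurves.ComplexMultiplicationLFunctionIsogenyHoldsProofs
import Literature.NumberTheory.EllipticCurves.AnalyticRankOrderProofs
import HarnessLib

/-!
# Row D4 ∩ {r = 0}: the DESCENT-CERTIFICATE road — `BSD(E,p)` for a rank-ZERO good Eisenstein
# curve with `ord_p #Ш_an = 2` from Wuthrich's upper bound, Cassels–Tate squareness and ONE finite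
# certificate `Ш(E)[p] ≠ 0` (a `p`-isogeny descent), read on the record or on an isogenous member

HONEST FRAMING (cell `bsd-litref`, programme `BSD-LIT2PART-PROGRAMME-v1.md` §T2d, verbatim): "no
tranche here proves BSD; ARM L moves the LITERAL column of an r ≤ 1 census into the kernel-proved-
modulo-named-print column". `Proofs`-style Summits file: THEOREMS ONLY (no definition, no new named
fact, no `sorry`). Seat `bsd-litref-cgs25-pv` (g2). Nothing is booked here; the desk books.

## What and why

Row D4 (flag `CGS25-BST-Thm311`) ∩ {r = 0}: 148 classes (145 at `p = 3`) — `p > 2` good, `E[p]`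
reducible, `a_p ≢ 1 (mod p)`, `ord_{s=1}L(E,s) = 0`, and `p ∣ #Ш_an(E)` on the record curve (140 of
them `#Ш_an = 9`). The MIRROR twist road (`MainConjecturesEisensteinRankZeroTwist.lean`, p465061;
referee A R413 + OFFER v2) certifies 88 of them; 60 classes (+ `427063l1`) have NO admissible two-step
twist pair under the lane's cost wall `N·d²·d'² ≤ 6·10¹⁵`. This file is the kernel side of a THIRD
road for exactly those classes, with NO modular parametrisation (hence NO Manin binder), NO Heegner
field, NO CGS25 / BSTW / `_OPEN` / flag binder:

* UPPER half `ord_p #Ш(E) ≤ ord_p #Ш_an(E)`: Wuthrich, Doc. Math. 19 (2014) Prop. 21 (`hW =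
  Wuthrich2014.sha_dvd_analyticSha`, C14; `L(E,1) ≠ 0`, `p` odd, `E` not additive at `p` — here GOOD —,
  image Borel-or-surjective — here Borel, `E[p]` reducible);
* LOWER half from ONE finite certificate: `#Ш(E)` is a perfect square (Cassels–Tate, `hCT =
  WeierstrassCurve.exists_casselsTate_pairing`, bsd.S18; Silverman AEC X.4.14), so `p ∣ #Ш(E)` forces
  `2 ≤ ord_p #Ш(E)`; with `ord_p #Ш_an(E) ≤ 2` equality follows (`Typed.bsdp_of_wuthrich_of_casselsTate_
  of_dvd`, x11b; precedent referee A R139.1: X2 `5568g1@3`, `19776h1@3`, flag-free "PUB + per-pair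
  certificate" on a two-engine `3`-descent);
* the certificate in its three currencies: `p ∣ #Ш(E/ℚ)`; one non-zero element of `Ш(E/ℚ)` killed by
  `p` (`Typed.dvd_shaOrder_of_exists_torsion`); the native `p`-descent line `Sel^(p)(E/ℚ) ≠ 0`
  (`Typed.exists_sha_torsion_of_selmerGroup_ne_bot`, rank `0` by GZK, `p ∤ #E(ℚ)_tors` DERIVED from
  `¬anom` by `not_dvd_torsionOrder_of_not_anom`). What a `p`-ISOGENY descent delivers is the second:
  for `φ : E → Ê` a rational `p`-isogeny with `E(ℚ)`, `Ê(ℚ)` finite of order prime to `p` (rank `0`,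
  `a_p ≢ 1`), `Sel^φ(E/ℚ) ≅ Ш(E/ℚ)[φ] ⊂ Ш(E/ℚ)[p]`, so `dim_𝔽ₚ Sel^φ(E/ℚ) ≥ 1` is a non-zero element of
  `Ш(E/ℚ)[p]` (Schaefer–Stoll 2004 §3; Miller–Stoll 2013 §6; the sha-2 engines `isogchi.gp` /
  `isogcft.gp` print `s_phi = dim Sel^φ(E)`, `s_hat = dim Sel^φ̂(Ê)`, `m`, `EXCESS = dim Ш(Ê)[φ̂] +
  dim Ш(E)[φ]`);
* ISOGENY-CLASS form: the certificate and `#Ш_an = p²·unit` are READ ON AN ISOGENOUS MEMBER `W'` (for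
  the three classes `298186d1`, `370300o1`, `383344m1` whose record curve has `#Ш_an = 81` but whose
  member 2 has `#Ш_an = 9`), and `BSDp` is transported to the record `W` by Cassels' isogeny invariance
  of the BSD quotient (`hCassels = bsdRHS_eq_of_isIsogenous`, Milne ADT I.7.3, through
  `Wuthrich2014.bsdp_of_isIsogenous`; `L(W',1) = L(W,1)` by Faltings, `entireLFunction_eq_of_isIsogenous'`).

Named facts displayed (all PUBLISHED, refereed): `hCT` (bsd.S18), `hW` (C14), `hGZK` (bsd.S17), `hmod`
(modularity), and `hCassels` in the class form. Per-record data: the T-CGS record hypotheses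
(`2 < p`, `Good`, `Red`, `¬Anom`, `r_an = 0`), `#Ш_an = q` with `ord_p q ≤ 2`, and the certificate.

References: [Wuthrich2014] Prop. 21 (p. 400); [SilvermanAEC2009] Thm. X.4.14; [MilneADT2006] Thm.
I.7.3, Rem. I.7.4; [Miller2011LMS] §1, Def. 1.1; [MillerStoll2013] §§6–7; Schaefer–Stoll, Trans. AMS
356 (2004) §3; tree: `Rank1Residual/Typed/CasselsLowerBound.lean`, `Typed/SelmerCardCertificateRankZero.lean`
(x11b), `Rank1Residual/X1RankZeroCertificate.lean` (x1b: the X1 = anomalous analogue).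
-/

set_option autoImplicit false

noncomputable section

open scoped Classical

open WeierstrassCurve Literature.NumberTheory.EllipticCurves
  Literature.NumberTheory.EllipticCurves.Rank1Residual
  Literature.NumberTheory.EllipticCurves.Rank1Residual.Typed

namespace Summit.BirchSwinnertonDyer.Rank1Residual

/-! ### The certificate on the record curve -/

/-- **Row D4 ∩ {r = 0}, descent-certificate road, divisibility currency, general `k`.** For `W/ℚ`
globally minimal elliptic, `p > 2` GOOD with `E[p]` REDUCIBLE, `ord_{s=1}L(E,s) = 0`, `#Ш_an(E) = q`
with `ord_p q ≤ 2k`, and the certificate `p^{2k-1} ∣ #Ш(E/ℚ)`: `BSDp W p`. Upper half Wuthrich 2014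
Prop. 21 (`hW`; good ⇒ not additive, `HasGoodReduction.not_hasAdditiveReduction`; reducible ⇒ Borel);
lower half Cassels–Tate squareness (`hCT`); `Ш` finite, `rank = 0` by GZK (`hGZK`); modularity
(`hmod`). The tree's class-free `Typed.bsdp_of_wuthrich_of_casselsTate_of_pow_dvd` at the row's data;
`¬anom` is not needed here. [cite: Wuthrich2014, Prop. 21 (p. 400)] [cite: SilvermanAEC2009, Thm. X.4.14]
[cite: Miller2011LMS, §1 and Def. 1.1] -/
theorem RowC6.bsdp_rankZero_of_casselsTate_of_pow_dvd
    (hCT : exists_casselsTate_pairing (K := ℚ)) (hW : Wuthrich2014.sha_dvd_analyticSha)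
    (hGZK : rank_eq_analyticRank_of_analyticRank_le_one) (hmod : hasEntireLFunction_rat)
    (W : WeierstrassCurve ℚ) [W.IsElliptic] [W.IsGloballyMinimal] (p : ℕ) [Fact p.Prime]
    (hp : 2 < p) (hgood : Good W p) (hred : Red W p) (hr0 : W.analyticRank = 0)
    {q : ℚ} (hq : shaAn W = (q : ℂ)) {k : ℕ} (hv : padicValRat p q ≤ 2 * k)
    (hdvd : p ^ (2 * k - 1) ∣ W.shaOrder) : BSDp W p :=
  bsdp_of_wuthrich_of_casselsTate_of_pow_dvd W p hCT hW hGZK hmod (by omega) hr0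
    (WeierstrassCurve.HasGoodReduction.not_hasAdditiveReduction (R := ℤ_[p]) hgood) (Or.inl hred)
    hq hv hdvd

/-- **Row D4 ∩ {r = 0}, descent-certificate road, `k = 1` (the census case `#Ш_an = p²`):** `p > 2`
good, `E[p]` reducible, `r_an = 0`, `ord_p #Ш_an ≤ 2`, certificate `p ∣ #Ш(E/ℚ)` ⇒ `BSDp W p`.
[cite: Wuthrich2014, Prop. 21 (p. 400)] [cite: SilvermanAEC2009, Thm. X.4.14]
[cite: Miller2011LMS, §1 and Def. 1.1] -/
theorem RowC6.bsdp_rankZero_of_casselsTate_of_dvd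
    (hCT : exists_casselsTate_pairing (K := ℚ)) (hW : Wuthrich2014.sha_dvd_analyticSha)
    (hGZK : rank_eq_analyticRank_of_analyticRank_le_one) (hmod : hasEntireLFunction_rat)
    (W : WeierstrassCurve ℚ) [W.IsElliptic] [W.IsGloballyMinimal] (p : ℕ) [Fact p.Prime]
    (hp : 2 < p) (hgood : Good W p) (hred : Red W p) (hr0 : W.analyticRank = 0)
    {q : ℚ} (hq : shaAn W = (q : ℂ)) (hv : padicValRat p q ≤ 2) (hdvd : p ∣ W.shaOrder) :
    BSDp W p :=
  RowC6.bsdp_rankZero_of_casselsTate_of_pow_dvd hCT hW hGZK hmod W p hp hgood hred hr0 hq (k := 1)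
    (by simpa using hv) (by simpa using hdvd)

/-- **Row D4 ∩ {r = 0}, descent-certificate road, ONE-ELEMENT currency** (what a `p`-isogeny descent
with `dim Sel^φ(E/ℚ) ≥ 1` at rank `0` without rational `p`-torsion on `E`, `Ê` delivers: a non-zero
class of `Ш(E/ℚ)[φ] ⊂ Ш(E/ℚ)[p]`): `p > 2` good, `E[p]` reducible, `r_an = 0`, `ord_p #Ш_an ≤ 2`, and
`∃ x ∈ Ш(E/ℚ), x ≠ 0, p·x = 0` ⇒ `BSDp W p` (`Typed.dvd_shaOrder_of_exists_torsion`, Lagrange).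
[cite: Wuthrich2014, Prop. 21 (p. 400)] [cite: SilvermanAEC2009, Thm. X.4.14]
[cite: MillerStoll2013, §§6–7] [cite: Miller2011LMS, §1 and Def. 1.1] -/
theorem RowC6.bsdp_rankZero_of_casselsTate_of_shaTorsion
    (hCT : exists_casselsTate_pairing (K := ℚ)) (hW : Wuthrich2014.sha_dvd_analyticSha)
    (hGZK : rank_eq_analyticRank_of_analyticRank_le_one) (hmod : hasEntireLFunction_rat)
    (W : WeierstrassCurve ℚ) [W.IsElliptic] [W.IsGloballyMinimal] (p : ℕ) [Fact p.Prime]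
    (hp : 2 < p) (hgood : Good W p) (hred : Red W p) (hr0 : W.analyticRank = 0)
    {q : ℚ} (hq : shaAn W = (q : ℂ)) (hv : padicValRat p q ≤ 2)
    (hx : ∃ x : W.sha, x ≠ 0 ∧ p • x = 0) : BSDp W p :=
  RowC6.bsdp_rankZero_of_casselsTate_of_dvd hCT hW hGZK hmod W p hp hgood hred hr0 hq hv
    (dvd_shaOrder_of_exists_torsion W p hx)

/-- **Row D4 ∩ {r = 0}, descent-certificate road, NATIVE `p`-descent currency `Sel^(p)(E/ℚ) ≠ 0`.**
`p > 2` good, `E[p]` reducible, `a_p ≢ 1 (mod p)`, `r_an = 0`, `ord_p #Ш_an ≤ 2`, `Sel^(p)(E/ℚ) ≠ ⊥` ⇒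
`BSDp W p`. The side conditions of `Typed.exists_sha_torsion_of_selmerGroup_ne_bot` are DERIVED:
`rank E(ℚ) = 0` from GZK at `r_an = 0`, and `p ∤ #E(ℚ)_tors` from `¬anom` at the good prime `p > 2`
(`not_dvd_torsionOrder_of_not_anom`, Silverman AEC VII.3). Composition:
`Typed.bsdp_of_wuthrich_of_casselsTate_of_selmerGroup_ne_bot`. [cite: Wuthrich2014, Prop. 21 (p. 400)]
[cite: SilvermanAEC2009, Thm. X.4.14 and VII.3.1(b)] [cite: Miller2011LMS, §1 and Def. 1.1] -/
theorem RowC6.bsdp_rankZero_of_casselsTate_of_selmerGroup_ne_bot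
    (hCT : exists_casselsTate_pairing (K := ℚ)) (hW : Wuthrich2014.sha_dvd_analyticSha)
    (hGZK : rank_eq_analyticRank_of_analyticRank_le_one) (hmod : hasEntireLFunction_rat)
    (W : WeierstrassCurve ℚ) [W.IsElliptic] [W.IsGloballyMinimal] (p : ℕ) [Fact p.Prime]
    (hp : 2 < p) (hgood : Good W p) (hred : Red W p) (hna : ¬ Anom W p) (hr0 : W.analyticRank = 0)
    {q : ℚ} (hq : shaAn W = (q : ℂ)) (hv : padicValRat p q ≤ 2)
    (hSel : W.selmerGroup (p : ℤ) ≠ ⊥) : BSDp W p :=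
  bsdp_of_wuthrich_of_casselsTate_of_selmerGroup_ne_bot W p hCT hW hGZK hmod (by omega) hr0
    (WeierstrassCurve.HasGoodReduction.not_hasAdditiveReduction (R := ℤ_[p]) hgood) (Or.inl hred)
    hq hv (not_dvd_torsionOrder_of_not_anom W p hp hgood hna) hSel

/-! ### The certificate on an ISOGENOUS member (Cassels' invariance of the BSD quotient) -/

/-- **Row D4 ∩ {r = 0}, descent-certificate road in ISOGENY-CLASS form, one-element currency.**
`W ∼ W'` over `ℚ` (both globally minimal elliptic), `ord_{s=1}L(W,s) = 0` (the record's rank); ON `W'`: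
`p > 2` good, `W'[p]` reducible, `#Ш_an(W') = q'` with `ord_p q' ≤ 2`, and a non-zero element of
`Ш(W'/ℚ)` killed by `p`. Then `BSDp W p`: `L(W',s) = L(W,s)` (Faltings / Knapp 11.67,
`analyticRank_eq_of_isIsogenous'`) so `r_an(W') = 0`; `BSD(W',p)` by
`RowC6.bsdp_rankZero_of_casselsTate_of_shaTorsion`; transport by Cassels (`hCassels`,
`Wuthrich2014.bsdp_of_isIsogenous`) with `Ш(W')` finite (GZK) and `L(W',1) ≠ 0` as leading coefficient
(modularity, `leadingLCoeff_ne_zero_holds`). Census use: `298186d1`, `370300o1`, `383344m1` @3 via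
member 2 (`#Ш_an = 9`). [cite: Wuthrich2014, Prop. 21 (p. 400)] [cite: SilvermanAEC2009, Thm. X.4.14]
[cite: MilneADT2006, Thm. I.7.3 and Remark I.7.4] [cite: Miller2011LMS, §1 and Def. 1.1] -/
theorem RowC6.isogenous_bsdp_rankZero_of_casselsTate_of_shaTorsion
    (hCassels : bsdRHS_eq_of_isIsogenous)
    (hCT : exists_casselsTate_pairing (K := ℚ)) (hW : Wuthrich2014.sha_dvd_analyticSha)
    (hGZK : rank_eq_analyticRank_of_analyticRank_le_one) (hmod : hasEntireLFunction_rat)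
    (W : WeierstrassCurve ℚ) [W.IsElliptic] [W.IsGloballyMinimal]
    (W' : WeierstrassCurve ℚ) [W'.IsElliptic] [W'.IsGloballyMinimal] (hiso : IsIsogenous W W')
    (p : ℕ) [Fact p.Prime] (hp : 2 < p) (hr0 : W.analyticRank = 0)
    (hgood' : Good W' p) (hred' : Red W' p)
    {q' : ℚ} (hq' : shaAn W' = (q' : ℂ)) (hv' : padicValRat p q' ≤ 2)
    (hx' : ∃ x : W'.sha, x ≠ 0 ∧ p • x = 0) : BSDp W p := by
  have hr0' : W'.analyticRank = 0 := by rw [← analyticRank_eq_of_isIsogenous' hiso]; exact hr0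
  have h' : BSDp W' p :=
    RowC6.bsdp_rankZero_of_casselsTate_of_shaTorsion hCT hW hGZK hmod W' p hp hgood' hred' hr0' hq'
      hv' hx'
  exact Wuthrich2014.bsdp_of_isIsogenous hCassels hiso (hGZK W' (by omega)).2
    (W'.leadingLCoeff_ne_zero_holds (hmod W')) h'

/-- **Row D4 ∩ {r = 0}, descent-certificate road in ISOGENY-CLASS form, native `p`-descent currency.**
As `RowC6.isogenous_bsdp_rankZero_of_casselsTate_of_shaTorsion`, with the certificate ON `W'` read as
`Sel^(p)(W'/ℚ) ≠ ⊥` and `a_p(W') ≢ 1 (mod p)` (`¬ Anom W' p`, whence `p ∤ #W'(ℚ)_tors`).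
[cite: Wuthrich2014, Prop. 21 (p. 400)] [cite: SilvermanAEC2009, Thm. X.4.14]
[cite: MilneADT2006, Thm. I.7.3 and Remark I.7.4] [cite: Miller2011LMS, §1 and Def. 1.1] -/
theorem RowC6.isogenous_bsdp_rankZero_of_casselsTate_of_selmerGroup_ne_bot
    (hCassels : bsdRHS_eq_of_isIsogenous)
    (hCT : exists_casselsTate_pairing (K := ℚ)) (hW : Wuthrich2014.sha_dvd_analyticSha)
    (hGZK : rank_eq_analyticRank_of_analyticRank_le_one) (hmod : hasEntireLFunction_rat)
    (W : WeierstrassCurve ℚ) [W.IsElliptic] [W.IsGloballyMinimal]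
    (W' : WeierstrassCurve ℚ) [W'.IsElliptic] [W'.IsGloballyMinimal] (hiso : IsIsogenous W W')
    (p : ℕ) [Fact p.Prime] (hp : 2 < p) (hr0 : W.analyticRank = 0)
    (hgood' : Good W' p) (hred' : Red W' p) (hna' : ¬ Anom W' p)
    {q' : ℚ} (hq' : shaAn W' = (q' : ℂ)) (hv' : padicValRat p q' ≤ 2)
    (hSel' : W'.selmerGroup (p : ℤ) ≠ ⊥) : BSDp W p := by
  have hr0' : W'.analyticRank = 0 := by rw [← analyticRank_eq_of_isIsogenous' hiso]; exact hr0
  have h' : BSDp W' p :=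
    RowC6.bsdp_rankZero_of_casselsTate_of_selmerGroup_ne_bot hCT hW hGZK hmod W' p hp hgood' hred'
      hna' hr0' hq' hv' hSel'
  exact Wuthrich2014.bsdp_of_isIsogenous hCassels hiso (hGZK W' (by omega)).2
    (W'.leadingLCoeff_ne_zero_holds (hmod W')) h'

end Summit.BirchSwinnertonDyer.Rank1Residual

end
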